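import Summits.QuantumFields.BalabanUV.Beta.SymmetrisedDressingKernel

/-!
# `BalabanUV.Beta.SymmetrisedDressingReflection` — binder row D1, JSB12SYM-SPINE v1.1 (Σ2) step K1-a part 3: REFLECTION INVARIANCE OF THE SYMMETRISED
# PROJECTOR KERNEL AND OF THE SYMMETRISED CO-DRESSED RESOLVENTS at the centred root (`N` odd): `refK (Φ N α) (piKSymBm ρ_c N) = piKSymBm ρ_c N`,
# `refK (Φ N α) (coDressKSymAt ρ_c N K) = coDressKSymAt ρ_c N K` for reflection-invariant spread `K` (e.g. `KInvStep Lc j`) — the hR feed of the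
# re-based dressing (verbatim port of `AxialDressingRootedBmReflection` §2 + `AxialDressingRootedBmKernel` §3 with `pmBm ↦ pmSymBm`, S1e∕S1f inside)

HONEST FRAMING (cell contract, verbatim): «discharging `BetaPertH` makes Bałaban's UV stability UNCONDITIONAL — a real constructive-QFT
result; it is NOT the continuum limit and NOT the Clay problem.»  THIS MODULE DISCHARGES NOTHING of `BetaPertH` ∕ row D1: [folklore] kernel
bookkeeping.  0 sorry, 0 `def … : Prop`, nothing cited ([Balaban1987RG1] p.293 (5.7)∕(5.13) is the locator of the reflection law).
Together with `SymmetrisedDressingKernel.permK_piKSymBm`∕`permK_coDressKSymAt` this gives the FULL hyperoctahedral invariance of the symmetrised dressing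
— the comb dressing `coDressKBmAt` has the reflection half only.  NOT D1, NOT BetaPertH, NOT continuum, NOT Clay.
CHART (RULING R-D1-g25-4): chart (II) — the FIXED κ = 0 slice `ker G_sym` with the block-orthogonal `symE`; the slice-exchange row hSX
(`R_SX`, an3-g46 THEOREM R, `b2b-balaban-beta-an3/gen46/FP-SYM.v1.md`) is a SEPARATE displayed binder of the literal and is NOT in this file.
HONEST DEPENDENCY (verbatim): «continuum YM on T⁴ ⇐ BetaPertH ∧ nine spine estimates (0/9 proved); BetaPertH ⇐ (D1) ∧ (D4) ∧ CAP+tail;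
G-an2-4 gates asym, D1 and NE2/3/4.»  ABSOLUTE RULE (cell, verbatim): «No internally-minted statement may enter as a cited fact. Every
hypothesis is either kernel-proved in this package or a verbatim quotation of a PUBLISHED theorem with page reference.»
Unit `b2b-balaban-beta-an2` gen 25 (row-D1 owner), 2026-08-21.
-/

namespace Summit.QuantumFields.BalabanUV.Beta.SymmetrisedDressingReflection

noncomputable section

open Finset
open scoped BigOperators Nat
open Literature.MathematicalPhysics.QuantumFieldTheory
open Literature.MathematicalPhysics.QuantumFieldTheory.Balaban1983to89
open Literature.MathematicalPhysics.QuantumFieldTheory.Balaban1983to89.Beta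
open ExpKernelCalculus (MKer Decays comp tr shiftK)
open AffineAveraging (Form0 Form1 Site box toSite unitVec unitVec_apply blockSum)
open AveragingContours (blk grad shift)
open AveragingContoursRooted (ctr ctrOff ctrOff_mem_box)
open RootedComb (ctr_eq_toSite grad_R0 R1_sub)
open PolarizationSign (reflSign)
open KernelReflection (LegMap refK refK_apply comp_refK)
open ResolventReflection (sref sref_apply bref bref_apply R0 R1 R0_apply R1_apply mref Φ Φ_r_inl Φ_r_inr Φ_s_inl Φ_s_inr reflSign_mul_self
  refK_KInvStep)
open OneStepResolventKernel (Fib)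
open OneStepKernelFamily (KInvStep decays_KInvStep)
open AxialProjector (zsmul_blk_le lt_zsmul_blk_add axial_map)
open Summit.QuantumFields.BalabanUV.Beta.TameKernelCalculus
open Summit.QuantumFields.BalabanUV.Beta.AxialDressingRooted
open Summit.QuantumFields.BalabanUV.Beta.ResolventPermutation (P1 P1_apply)
open Summit.QuantumFields.BalabanUV.Beta.AxialProjectorBlockMean (blockMeanAt)
open Summit.QuantumFields.BalabanUV.Beta.SymmetrisedAxialPotential
open Summit.QuantumFields.BalabanUV.Beta.SymmetrisedAxialGauge
open Summit.QuantumFields.BalabanUV.Beta.SymmetrisedAxialReflection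
open Summit.QuantumFields.BalabanUV.Beta.SymmetrisedAxialGaugeBlockMean
open Summit.QuantumFields.BalabanUV.Beta.SymmetrisedDressingMatrix
open Summit.QuantumFields.BalabanUV.Beta.SymmetrisedDressingKernel

variable {d : ℕ}

/-! ## §1 Homogeneity and the reflection law of the matrix `pmSymBm` -/

/-- [folklore] The transported comb integral is homogeneous under left multiplication of the form by a constant. -/
theorem axialPerm_mulLeft (σ : Equiv.Perm (Fin (d + 1))) (c : ℝ) (A : Form1 (d + 1) ℝ) (y x : Site (d + 1)) :
    axialPerm σ (fun κ z => c * A κ z) y x = c * axialPerm σ A y x := by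
  unfold axialPerm
  have hP : P1 σ (fun κ z => c * A κ z) = fun κ z => (AddMonoidHom.mulLeft c) (P1 σ A κ z) := by
    funext κ z; simp only [P1_apply, AddMonoidHom.coe_mulLeft]
  rw [hP, axial_map, ← map_list_sum]
  rfl

/-- [folklore] The symmetrised tree gauge is homogeneous. -/
theorem symTreeGaugeAt_mulLeft (ρ : Site (d + 1)) (c : ℝ) (A : Form1 (d + 1) ℝ) (N : ℕ) (x : Site (d + 1)) :
    symTreeGaugeAt ρ (fun κ z => c * A κ z) N x = c * symTreeGaugeAt ρ A N x := by
  simp only [symTreeGaugeAt, symAxial, axialPerm_mulLeft, Finset.mul_sum]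

/-- [folklore] `Π^{sym}_bm` is homogeneous (pointwise form). -/
theorem symAxProjBmAt_mulLeft (ρ : Site (d + 1)) (N : ℕ) (c : ℝ) (A : Form1 (d + 1) ℝ) (κ : Fin (d + 1)) (x : Site (d + 1)) :
    symAxProjBmAt ρ N (fun κ z => c * A κ z) κ x = c * symAxProjBmAt ρ N A κ x := by
  have hg : symGaugeAt ρ (fun κ z => c * A κ z) N = fun y => c * symGaugeAt ρ A N y := by
    funext y; rw [symGaugeAt, symGaugeAt, symTreeGaugeAt_mulLeft]; ring
  have hbs : ∀ y, blockSum N (fun y => c * symGaugeAt ρ A N y) y = c * blockSum N (symGaugeAt ρ A N) y := fun y => by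
    simp only [blockSum, Finset.mul_sum]
  simp only [symAxProjBmAt, symBmGaugeAt, blockMeanAt, grad, Pi.sub_apply, hg, hbs]
  ring

/-- [folklore] **THE REFLECTION LAW OF THE MATRIX** (centred root, `N` odd): `pmSymBm ρ_c N b p a q = ε_a ε_b · pmSymBm ρ_c N b (bref α b p) a (bref α a q)`
(S1f's `symAxProjBmAt_R1` + `R1_bondInd`; cf. the comb's `pmBm_refl`). -/
theorem pmSymBm_refl {N : ℕ} (hN : Odd N) (α b : Fin (d + 1)) (p : Site (d + 1)) (a : Fin (d + 1)) (q : Site (d + 1)) :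
    pmSymBm (toSite (ctrOff (d + 1) N)) N b p a q =
      reflSign α a * reflSign α b * pmSymBm (toSite (ctrOff (d + 1) N)) N b (bref α b p) a (bref α a q) := by
  have key := congrFun (congrFun (symAxProjBmAt_R1 hN α (bondIndR a (bref α a q))) b) p
  rw [← ctr_eq_toSite]
  unfold pmSymBm
  have eR : R1 α (symAxProjBmAt (ctr (d + 1) N) N (bondIndR a (bref α a q))) b p =
      reflSign α b * symAxProjBmAt (ctr (d + 1) N) N (bondIndR a (bref α a q)) b (bref α b p) := rfl
  have eL : symAxProjBmAt (ctr (d + 1) N) N (R1 α (bondIndR a (bref α a q))) b p =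
      reflSign α a * symAxProjBmAt (ctr (d + 1) N) N (bondIndR a q) b p := by
    have hR : R1 α (bondIndR a (bref α a q)) = fun κ x => reflSign α a * bondIndR a q κ x := by
      have h := R1_bondInd α a q
      unfold bondIndR
      exact h
    rw [hR]
    exact symAxProjBmAt_mulLeft (ctr (d + 1) N) N (reflSign α a) (bondIndR a q) b p
  rw [eL, eR] at key
  have hs := reflSign_mul_self α a
  calc symAxProjBmAt (ctr (d + 1) N) N (bondIndR a q) b p
      = reflSign α a * reflSign α a * symAxProjBmAt (ctr (d + 1) N) N (bondIndR a q) b p := by rw [hs, one_mul]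
    _ = reflSign α a * (reflSign α b * symAxProjBmAt (ctr (d + 1) N) N (bondIndR a (bref α a q)) b (bref α b p)) := by
        rw [mul_assoc, key]
    _ = _ := by ring

/-! ## §2 The support of `pmSymBm` in coordinates and the reflected window -/

/-- [folklore] **SUPPORT OF `pmSymBm` IN COORDINATES** (in-block root): `pmSymBm (toSite r) N b p a q ≠ 0` forces `|p_i − q_i| ≤ N − 1` for `i ≠ b` and
`−N ≤ p_i − q_i ≤ N − 1` — the conclusion of the comb's `pmBm_ne_zero` VERBATIM (so the comb's window proofs transplant). -/
theorem pmSymBm_ne_zero {N : ℕ} (hN : 1 ≤ N) {r : Fin (d + 1) → ℕ} (hr : r ∈ box (d + 1) N) {b : Fin (d + 1)} {p : Site (d + 1)} {a : Fin (d + 1)}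
    {q : Site (d + 1)} (h : pmSymBm (toSite r) N b p a q ≠ 0) (i : Fin (d + 1)) :
    (i ≠ b → |p i - q i| ≤ (N : ℤ) - 1) ∧ (-(N : ℤ) ≤ p i - q i ∧ p i - q i ≤ (N : ℤ) - 1) := by
  -- the bond `(a,q)` lies in the block of `p`, or in the block of `p + e_b`, or `(b,p) = (a,q)`
  have hcase : blk N q = blk N p ∨ blk N q = blk N (p + unitVec b) ∨ (b = a ∧ p = q) := by
    rw [pmSymBm_eq] at h
    by_cases h1 : blk N q = blk N p
    · exact Or.inl h1
    by_cases h2 : blk N q = blk N (p + unitVec b)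
    · exact Or.inr (Or.inl h2)
    by_cases h3 : b = a ∧ p = q
    · exact Or.inr (Or.inr h3)
    exfalso
    apply h
    have e0 : bondIndR a q b p = 0 := by rw [bondIndR_apply, if_neg h3]
    have g2 : symGaugeAt (toSite r) (bondIndR a q) N p = 0 := by
      by_contra h0; exact h1 (symGaugeAt_bondIndR_ne_zero_blk hN hr h0).1
    have g1 : symGaugeAt (toSite r) (bondIndR a q) N (p + unitVec b) = 0 := by
      by_contra h0; exact h2 (symGaugeAt_bondIndR_ne_zero_blk hN hr h0).1
    have g4 : blockMeanAt N (symGaugeAt (toSite r) (bondIndR a q) N) p = 0 := by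
      by_contra h0; exact h1 (blockMeanAt_symGaugeAt_bondIndR_ne_zero_blk hN hr h0).1
    have g3 : blockMeanAt N (symGaugeAt (toSite r) (bondIndR a q) N) (p + unitVec b) = 0 := by
      by_contra h0; exact h2 (blockMeanAt_symGaugeAt_bondIndR_ne_zero_blk hN hr h0).1
    rw [e0, g1, g2, g3, g4]; ring
  have hN1 : (1 : ℤ) ≤ N := by exact_mod_cast hN
  rcases hcase with k | k | ⟨-, hpq⟩
  · have a1 := zsmul_blk_le hN p i
    have a2 := lt_zsmul_blk_add hN p i
    have b1 := zsmul_blk_le hN q i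
    have b2 := lt_zsmul_blk_add hN q i
    rw [k] at b1 b2
    refine ⟨fun _ => ?_, ?_, ?_⟩
    · rw [abs_le]; constructor <;> omega
    · omega
    · omega
  · have a1 := zsmul_blk_le hN (p + unitVec b) i
    have a2 := lt_zsmul_blk_add hN (p + unitVec b) i
    have b1 := zsmul_blk_le hN q i
    have b2 := lt_zsmul_blk_add hN q i
    rw [k] at b1 b2
    simp only [Pi.add_apply, unitVec_apply] at a1 a2
    refine ⟨fun hib => ?_, ?_, ?_⟩
    · rw [if_neg hib] at a1 a2; rw [abs_le]; constructor <;> omega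
    · by_cases hib : i = b
      · rw [if_pos hib] at a1 a2; omega
      · rw [if_neg hib] at a1 a2; omega
    · by_cases hib : i = b
      · rw [if_pos hib] at a1 a2; omega
      · rw [if_neg hib] at a1 a2; omega
  · subst hpq
    refine ⟨fun _ => ?_, ?_, ?_⟩
    · rw [sub_self, abs_zero]; omega
    · rw [sub_self]; omega
    · rw [sub_self]; omega

/-- [folklore] **THE REFLECTED WINDOW**: `pmSymBm ≠ 0 ⇒ bref α b p − bref α a q ∈ cube` (the comb's `window_refl_of_pmBm_ne_zero`, same proof over
`pmSymBm_ne_zero`). -/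
theorem window_refl_of_pmSymBm_ne_zero {N : ℕ} (hN : 1 ≤ N) {r : Fin (d + 1) → ℕ} (hr : r ∈ box (d + 1) N) {b : Fin (d + 1)} {p : Site (d + 1)}
    {a : Fin (d + 1)} {q : Site (d + 1)} (h : pmSymBm (toSite r) N b p a q ≠ 0) (α : Fin (d + 1)) :
    bref α b p - bref α a q ∈ cube (d + 1) N := by
  rw [mem_cube]
  intro i
  have k := pmSymBm_ne_zero hN hr h i
  rw [Pi.sub_apply, bref_apply, bref_apply, abs_le]
  by_cases hiα : i = α
  · rw [if_pos hiα, if_pos hiα]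
    by_cases hb : b = α <;> by_cases ha : a = α
    · rw [if_pos hb, if_pos ha]; have := k.2; constructor <;> omega
    · rw [if_pos hb, if_neg ha]; have := k.2; constructor <;> omega
    · rw [if_neg hb, if_pos ha]
      have hib : i ≠ b := fun e => hb (e ▸ hiα)
      have := abs_le.1 (k.1 hib); constructor <;> omega
    · rw [if_neg hb, if_neg ha]
      have := k.2; constructor <;> omega
  · rw [if_neg hiα, if_neg hiα]
    have := k.2; constructor <;> omega

/-! ## §3 Reflection invariance of the kernel and of the co-dressed resolvents -/

/-- [folklore] **`refK (Φ N α) (piKSymBm ρ_c N) = piKSymBm ρ_c N`** (`N` odd, every axis). -/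
theorem refK_piKSymBm {N : ℕ} (hN : Odd N) (α : Fin (d + 1)) :
    refK (Φ N α) (piKSymBm (toSite (ctrOff (d + 1) N)) N) = piKSymBm (d := d) (toSite (ctrOff (d + 1) N)) N := by
  have hN1 : 1 ≤ N := hN.pos
  have hr : ctrOff (d + 1) N ∈ box (d + 1) N := ctrOff_mem_box hN1
  funext x x' a b
  rw [refK_apply]
  rcases a with a | m <;> rcases b with b | m'
  · simp only [Φ_s_inl, Φ_r_inl, piKSymBm_inl_inl]
    by_cases h0 : pmSymBm (toSite (ctrOff (d + 1) N)) N b x' a x = 0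
    · have h0' : pmSymBm (toSite (ctrOff (d + 1) N)) N b (bref α b x') a (bref α a x) = 0 := by
        have e := pmSymBm_refl hN α b x' a x
        rw [h0] at e
        have hsa := reflSign_mul_self α a
        have hsb := reflSign_mul_self α b
        have : reflSign α a * reflSign α b ≠ 0 := by
          intro hz
          have := congrArg (fun t => t * (reflSign α a * reflSign α b)) hz
          simp only [zero_mul] at this
          nlinarith [hsa, hsb]
        rcases mul_eq_zero.1 e.symm with h1 | h1
        · exact absurd h1 this
        · exact h1
      rw [h0']
      split_ifs <;> simp [h0]
    · rw [if_pos (window_refl_of_pmSymBm_ne_zero hN1 hr h0 α), if_pos (window_of_pmSymBm_ne_zero hN1 hr h0), pmSymBm_refl hN α b x' a x]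
  · simp [piKSymBm_inl_inr]
  · simp [piKSymBm_inr_inl]
  · simp only [Φ_s_inr, Φ_r_inr, piKSymBm_inr_inr]
    by_cases hm : m = m'
    · subst hm
      rw [reflSign_mul_self, one_mul]
      by_cases hx : x = x'
      · subst hx; simp
      · have hx' : mref N α m x ≠ mref N α m x' := fun e => hx (mref_inj.1 e)
        simp [hx, hx']
    · simp [hm]

/-- [folklore] **REFLECTION INVARIANCE OF THE SYMMETRISED CO-DRESSED KERNEL** (centred root, `N` odd, `K` spread and reflection-invariant). -/
theorem refK_coDressKSymAt {N : ℕ} (hN : Odd N) {K : MKer (d + 1) (Fib d)} (hK : Spr K) (α : Fin (d + 1)) (hKr : refK (Φ N α) K = K) :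
    refK (Φ N α) (coDressKSymAt (toSite (ctrOff (d + 1) N)) N K) = coDressKSymAt (toSite (ctrOff (d + 1) N)) N K := by
  have hN1 : 1 ≤ N := hN.pos
  have hr : ctrOff (d + 1) N ∈ box (d + 1) N := ctrOff_mem_box hN1
  have sP : Spr (piKSymBm (d := d) (toSite (ctrOff (d + 1) N)) N) := spr_piKSymBm hN1 hr
  have sPt : Spr (trK (piKSymBm (d := d) (toSite (ctrOff (d + 1) N)) N)) := spr_trK_piKSymBm hN1 hr
  rw [coDressKSymAt_eq, ← comp_refK (Φ N α) (fun x z a f b => slice_tame (spr_comp sPt hK).tame sP.tame x z a f b),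
    ← comp_refK (Φ N α) (fun x z a f b => slice_tame sPt.tame hK.tame x z a f b), refK_trK, refK_piKSymBm hN α, hKr]

/-- [folklore] … in particular for the decimated composite resolvents `KInvStep Lc j` — the hR feed of the re-based dressing (with `permK_coDressKSymAt` +
`permK_KInvStep`: the full hyperoctahedral feed). -/
theorem refK_coDressKSymAt_KInvStep {Lc : ℕ} [NeZero Lc] (hLc : Odd Lc) (j : ℕ) (α : Fin (d + 1)) :
    refK (Φ Lc α) (coDressKSymAt (toSite (ctrOff (d + 1) Lc)) Lc (KInvStep (d := d) Lc j)) =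
      coDressKSymAt (toSite (ctrOff (d + 1) Lc)) Lc (KInvStep (d := d) Lc j) := by
  obtain ⟨δ, C, hδ, -, hK⟩ := decays_KInvStep (d := d) (Lc := Lc) j
  exact refK_coDressKSymAt hLc ⟨C, δ, hδ, hK⟩ α (refK_KInvStep j α)

end

end Summit.QuantumFields.BalabanUV.Beta.SymmetrisedDressingReflection
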